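import Mathlib
import Summits.Ventures.PercRepro2.SwOutCoreCube
import Summits.Ventures.PercRepro2.SwOutShadowIneq
import Summits.Ventures.PercRepro2.SwOutArmGTyped

/-!
# The core cube and the shadow cube on the general doubly typed side (blind cell PercRepro2,
night-4 g33, 2026-08-28; proofs/NIGHT4-G33.md §2)

g13's two cube inequalities (`CoreBase.card_coreCube_le`, `ShadowBase.card_shadowCube_le`) for
g7's general doubly typed class `gTypedQ ends l h 𝓤 𝓓 𝓓″ X 𝓤′` in place of the principal
conditioning `Q`: along both cubes the red cluster of `l` shrinks, the blue cluster of `l` grows,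
the red cluster of `h` grows, the blue cluster of `h` shrinks, and the hull of `h` stays inside the
hull of the base — so the five conditions pull back to a LOWER set of the cube
(`coreReal_mem_gTypedQ_of_le`, `shadowReal_mem_gTypedQ_of_le`; the vertices of `X` must avoid the
hull of the base), and the cube principle `card_le_of_cube_edges` gives the rigid counting
inequality (`card_coreCube_le_g`, `card_shadowCube_le_g`).  No blindness condition: the
monotonicities have the right direction for every up-set / down-set.
-/

namespace Summit.Ventures.PercRepro2

namespace LocRows

open Hull

variable {V : Type*} {E : Type*}

open scoped Classical

variable {ends : E → Sym2 V}

section CoreCube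

variable [Fintype E] [DecidableEq E]
variable {ι : Type*} {A : ι → Set V} {pure : ι → Prop} {ζ : Config E} {h u : V} {H : Set V}
  (hb : CoreBase ends ζ h u H A pure)
include hb

omit [Fintype E] [DecidableEq E] in
/-- The blue cluster of `h` shrinks going up the core cube. -/
lemma CoreBase.cluster_blue_coreReal_anti {ω ω' : Config ι} (hω : ω ≤ ω') :
    cluster ends (blue (coreReal ends A ζ ω')) h ⊆ cluster ends (blue (coreReal ends A ζ ω)) h := by
  rw [hb.blue_coreReal, hb.blue_coreReal]
  exact hb.dual.cluster_coreReal_mono (flipAll_le_flipAll hω)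

/-- **The general doubly typed conditioning pulls back to a lower set of the core cube** (`l ∉ H`,
`X` outside `H`). -/
theorem CoreBase.coreReal_mem_gTypedQ_of_le {l : V} {𝓤 𝓓 𝓓'' : Set (Set V)} {X : Set V}
    {𝓤' : Set (Set V)} (h𝓤 : IsUpperSet 𝓤) (h𝓓 : IsLowerSet 𝓓) (h𝓓'' : IsLowerSet 𝓓'')
    (h𝓤' : IsUpperSet 𝓤') (hl : l ∉ H) (hX : ∀ x ∈ X, x ∉ H) {ω ω' : Config ι} (hω : ω ≤ ω')
    (hQ : coreReal ends A ζ ω' ∈ gTypedQ ends l h 𝓤 𝓓 𝓓'' X 𝓤') :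
    coreReal ends A ζ ω ∈ gTypedQ ends l h 𝓤 𝓓 𝓓'' X 𝓤' := by
  rw [mem_gTypedQ] at hQ ⊢
  obtain ⟨-, hA, hB, hRh, -, hBh⟩ := hQ
  refine ⟨?_, h𝓤 (hb.cluster_l_coreReal_anti hl hω) hA,
    h𝓓 (hb.cluster_blue_l_coreReal_mono hl hω) hB, h𝓓'' (hb.cluster_coreReal_mono hω) hRh, ?_,
    h𝓤' (hb.cluster_blue_coreReal_anti hω) hBh⟩
  · rintro (hh | hh)
    · exact hl (hb.cluster_coreReal_subset ω (conn_symm hh))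
    · exact hl (hb.hull_coreReal_subset ω (Or.inr (conn_symm hh)))
  · intro x hx hxH
    exact hX x hx (hb.hull_coreReal_subset ω hxH)

/-- **THE CORE CUBE INEQUALITY, GENERAL DOUBLY TYPED SIDE**: the rigid counting inequality on
`gTypedQ` over the core cube of a core base (`H ⊆ U`, `l ∉ U`, `X` outside `H`). -/
theorem CoreBase.card_coreCube_le_g [Fintype ι] {U : Set V} {l : V} {𝓤 𝓓 𝓓'' : Set (Set V)}
    {X : Set V} {𝓤' : Set (Set V)} (h𝓤 : IsUpperSet 𝓤) (h𝓓 : IsLowerSet 𝓓)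
    (h𝓓'' : IsLowerSet 𝓓'') (h𝓤' : IsUpperSet 𝓤') (hHU : H ⊆ U) (hl : l ∉ U)
    (hX : ∀ x ∈ X, x ∉ H) {𝓔 : Set (Set E)} (h𝓔 : IsUpperSet 𝓔) :
    ((coreCube ends A ζ).filter fun ζ' =>
        ζ' ∈ gTypedQ ends l h 𝓤 𝓓 𝓓'' X 𝓤' ∧ redEdges ends ζ' h ∈ 𝓔).card ≤
      ((coreCube ends A ζ).filter fun ζ' =>
        ζ' ∈ gTypedQ ends l h 𝓤 𝓓 𝓓'' X 𝓤' ∧ blueEdges ends ζ' h ∈ 𝓔).card := by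
  have hlH : l ∉ H := fun h' => hl (hHU h')
  have key := card_le_of_cube_edges (ends := ends) (coreReal ends A ζ) hb.coreReal_injective
    (coreCube ends A ζ) (fun ζ' => mem_coreCube)
    (↑(gTypedQ ends l h 𝓤 𝓓 𝓓'' X 𝓤'))
    (fun ω' ω hω hQ => hb.coreReal_mem_gTypedQ_of_le h𝓤 h𝓓 h𝓓'' h𝓤' hlH hX hω hQ) h
    (fun 𝓔' h𝓔' ω ω' hω hω𝓔 => h𝓔' (hb.redEdges_coreReal_mono hω) hω𝓔)
    (fun 𝓔' h𝓔' ω' ω hω hω𝓔 => h𝓔' (hb.blueEdges_coreReal_anti hω) hω𝓔)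
    (fun ω => hb.blueEdges_coreReal_flipAll ω) h𝓔
  simpa only [Finset.mem_coe] using key

end CoreCube

section ShadowCube

variable [Fintype E] [DecidableEq E]
variable {κ : Type*} {B : κ → Set V} {Z : Set V} {k₀ : κ} {σ : Config E} {h : V}
  (hb : ShadowBase ends σ h Z B k₀)
include hb

omit [Fintype E] [DecidableEq E] in
/-- The red cluster of `h` grows with the shadow point. -/
lemma ShadowBase.cluster_shadowReal_mono {ω ω' : Config κ} (hω : ω ≤ ω') :
    cluster ends (shadowReal ends B Z k₀ σ ω) h ⊆ cluster ends (shadowReal ends B Z k₀ σ ω') h := by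
  rw [hb.cluster_shadowReal, hb.cluster_shadowReal]
  exact hb.sRed_mono hω

omit [Fintype E] [DecidableEq E] in
/-- The blue cluster of `h` shrinks going up the shadow cube. -/
lemma ShadowBase.cluster_blue_shadowReal_anti {ω ω' : Config κ} (hω : ω ≤ ω') :
    cluster ends (blue (shadowReal ends B Z k₀ σ ω')) h ⊆
      cluster ends (blue (shadowReal ends B Z k₀ σ ω)) h := by
  rw [hb.cluster_blue_shadowReal, hb.cluster_blue_shadowReal]
  exact hb.sRed_mono (flipAll_le_flipAll hω)

/-- **The general doubly typed conditioning pulls back to a lower set of the shadow cube**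
(`l` and `X` outside `{h} ∪ arms ∪ Z`). -/
theorem ShadowBase.shadowReal_mem_gTypedQ_of_le {l : V} {𝓤 𝓓 𝓓'' : Set (Set V)} {X : Set V}
    {𝓤' : Set (Set V)} (h𝓤 : IsUpperSet 𝓤) (h𝓓 : IsLowerSet 𝓓) (h𝓓'' : IsLowerSet 𝓓'')
    (h𝓤' : IsUpperSet 𝓤') (hl : l ∉ {h} ∪ {x | ∃ j, x ∈ B j} ∪ Z)
    (hX : ∀ x ∈ X, x ∉ {h} ∪ {x | ∃ j, x ∈ B j} ∪ Z) {ω ω' : Config κ} (hω : ω ≤ ω')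
    (hQ : shadowReal ends B Z k₀ σ ω' ∈ gTypedQ ends l h 𝓤 𝓓 𝓓'' X 𝓤') :
    shadowReal ends B Z k₀ σ ω ∈ gTypedQ ends l h 𝓤 𝓓 𝓓'' X 𝓤' := by
  rw [mem_gTypedQ] at hQ ⊢
  obtain ⟨-, hA, hB, hRh, -, hBh⟩ := hQ
  refine ⟨?_, h𝓤 (hb.cluster_l_shadowReal_anti hl hω) hA,
    h𝓓 (hb.cluster_blue_l_shadowReal_mono hl hω) hB, h𝓓'' (hb.cluster_shadowReal_mono hω) hRh,
    ?_, h𝓤' (hb.cluster_blue_shadowReal_anti hω) hBh⟩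
  · rintro (hh | hh)
    · exact hl (Or.inl (hb.hull_shadowReal_subset ω (Or.inl (conn_symm hh))))
    · exact hl (Or.inl (hb.hull_shadowReal_subset ω (Or.inr (conn_symm hh))))
  · intro x hx hxH
    exact hX x hx (Or.inl (hb.hull_shadowReal_subset ω hxH))

/-- **THE SHADOW CUBE INEQUALITY, GENERAL DOUBLY TYPED SIDE**: the rigid counting inequality on
`gTypedQ` over the shadow cube of a shadow base (`l` and `X` outside `{h} ∪ arms ∪ Z`). -/
theorem ShadowBase.card_shadowCube_le_g [Fintype κ] {l : V} {𝓤 𝓓 𝓓'' : Set (Set V)} {X : Set V}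
    {𝓤' : Set (Set V)} (h𝓤 : IsUpperSet 𝓤) (h𝓓 : IsLowerSet 𝓓) (h𝓓'' : IsLowerSet 𝓓'')
    (h𝓤' : IsUpperSet 𝓤') (hl : l ∉ {h} ∪ {x | ∃ j, x ∈ B j} ∪ Z)
    (hX : ∀ x ∈ X, x ∉ {h} ∪ {x | ∃ j, x ∈ B j} ∪ Z) {𝓔 : Set (Set E)} (h𝓔 : IsUpperSet 𝓔) :
    ((shadowCube ends B Z k₀ σ).filter fun ζ' =>
        ζ' ∈ gTypedQ ends l h 𝓤 𝓓 𝓓'' X 𝓤' ∧ redEdges ends ζ' h ∈ 𝓔).card ≤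
      ((shadowCube ends B Z k₀ σ).filter fun ζ' =>
        ζ' ∈ gTypedQ ends l h 𝓤 𝓓 𝓓'' X 𝓤' ∧ blueEdges ends ζ' h ∈ 𝓔).card := by
  have key := card_le_of_cube_edges (ends := ends) (shadowReal ends B Z k₀ σ)
    hb.shadowReal_injective (shadowCube ends B Z k₀ σ) (fun ζ' => mem_shadowCube)
    (↑(gTypedQ ends l h 𝓤 𝓓 𝓓'' X 𝓤'))
    (fun ω' ω hω hQ => hb.shadowReal_mem_gTypedQ_of_le h𝓤 h𝓓 h𝓓'' h𝓤' hl hX hω hQ) h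
    (fun 𝓔' h𝓔' ω ω' hω hω𝓔 => h𝓔' (hb.redEdges_shadowReal_mono hω) hω𝓔)
    (fun 𝓔' h𝓔' ω' ω hω hω𝓔 => h𝓔' (hb.blueEdges_shadowReal_anti hω) hω𝓔)
    (fun ω => hb.blueEdges_shadowReal_flipAll ω) h𝓔
  simpa only [Finset.mem_coe] using key

end ShadowCube

end LocRows

end Summit.Ventures.PercRepro2
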